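import Literature.MathematicalPhysics.QuantumFieldTheory.Balaban1983to89.B9LocalGaugeZeroModesY
import Literature.MathematicalPhysics.QuantumFieldTheory.Balaban1983to89.B6SectADeltaACoerciveOneLevelV1

/-!
# `Balaban1983to89.B9LocalAxialDecompositionY` — T. Bałaban, *Propagators and renormalization transformations for lattice gauge theories. II*,
# Commun. Math. Phys. **96** (1984) 223–250 [Balaban1984PropagatorsII], (2.7) p. 224 with (2.121) p. 244, LOCALISED AT A CUBE: **the SUPPORTED axial
# decomposition `χ·A = B + ∂λ` on def-Y's box — `λ ∈ N(Q′)` SUPPORTED IN THE CUBE SITE SET `D`, `B` axially gauged on every block inside `D` and ZERO on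
# every bond with both end points outside `D`** (the decomposition letter (Rᴰ) of the local centre number `m_□` of [B9] Thm 3.11's local road)

T. Bałaban, *Propagators for lattice gauge theories in a background field*, Commun. Math. Phys. **99** (1985) 389–434 [Balaban1985BackgroundPropagators] p. 416
(«the operators G_□ … In [4] we have proved that the operator G_□(1) is positive»); [4] = [Balaban1984PropagatorsII].
Statement-level skeleton with citation tags; proofs where landed; nothing here is a claim about the Yang–Mills mass gap.

THE PRINT (verbatim).  [Balaban1984PropagatorsII] p. 224, (2.7): *«λ: A → A^λ = A − ∂λ such that λ = 0 on Λ₀, Q′_jλ = 0 on Λ_j»*; p. 244, (2.121): *«B(b) = 0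
for b ⊂ Γ_{y,x}, x ∈ B(y), y ∈ Λ′»*; p. 239 (2.90): the LOCAL operator on `□̃` with Dirichlet data.

WHY THIS FILE (cell context, 2026-08-28).  Row 17's local centre number `m_□` is reduced (this seat, `Summits/…/BalabanUVNodesN06Row17LocalCentre{CoerciveReduction,
LettersOfRealLetters}`) to REAL letters about def-Y's flat kernels; the decomposition letter reads
(Rᴰ) `∀ v, ∃ g, qpK·g = 0 ∧ supp g ⊆ D ∧ χ·v − gradK·g ∈ 𝒯ᵣ(D)`,
with the real gauged class `𝒯ᵣ(D)` := «staircase sums from the block corner vanish on every block of `𝔅` inside `D`, and the field vanishes on every bond with both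
end points outside `D`».  dag-n10-c's ROAD «C» station C2 (`B6SectATreeGaugeDecompositionV1.exists_treeGauge_decomposition`) PROVED the GLOBAL decomposition for
r03∕p21's V1 family with arbitrary base points; THIS FILE localises it — take C2's `λ` for `A := χ·v` (base points the corners `cornerV1`), CUT it to `D`
(`g := 𝟙_D·λ` through the chart): since `D` is a union of blocks, the block means of `g` vanish (`qpK·g = 0`); on a block inside `D` the staircase sums of
`χ·v − ∂g` are those of `χ·v − ∂λ` because a gradient's staircase sum only reads the end points (`stairSum_grad`) — NO staircase geometry is needed; on a bond with
both ends outside `D` both `χ·v` (the cut issues from `D`) and `∂g` vanish.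
* ★★★ `exists_supported_axial_decomposition` — (Rᴰ) at def-Y's box kernels `gradK`, `qpK` (sites through `chartY`), for every `D` that is a union of blocks of the
  member's partition and every cut `χ` issuing from `D` (`χ(b) ≠ 0 → b₋ ∈ D`, the shape of `…LocalClauseOnReg335OfBall`'s `hχD`).
HONEST SCOPE.  Elementary bookkeeping over a landed kernel theorem (dag-n10-c C2); no inequality of [4] or [B9]; NOT a node discharge; count-neutral; one finite 𝕋⁴
programme — nothing about the mass gap.  Cell `pub-ymgap` (D-0062), node N06 [B9] × N10 ROAD «C», seat `pub-ymgap-dag-n06-j` gen 24, 2026-08-28.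
No `sorry`∕`axiom`∕`instance`∕`def`.
-/

noncomputable section

namespace Literature.MathematicalPhysics.QuantumFieldTheory.Balaban1983to89.B9LocalAxialDecompositionY

open Literature.MathematicalPhysics.QuantumFieldTheory.Balaban1983to89
open Literature.MathematicalPhysics.QuantumFieldTheory.Balaban1983to89.Node00
open Literature.MathematicalPhysics.QuantumFieldTheory.Balaban1983to89.B6KLevelCensusIndexV1 (KIdx)
open Literature.MathematicalPhysics.QuantumFieldTheory.Balaban1983to89.B6GlobalChartV1 (PV boxEquiv domT)
open Literature.MathematicalPhysics.QuantumFieldTheory.Balaban1983to89.B6SectAOperatorsV1 (dE QpE mem_ker_QpE_iff)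
open Literature.MathematicalPhysics.QuantumFieldTheory.Balaban1983to89.B6SectATreeGaugeDecompositionV1 (exists_treeGauge_decomposition stairSum_sub_dE)
open Literature.MathematicalPhysics.QuantumFieldTheory.Balaban1983to89.B6SectALemma24OneLevelV1 (cornerV1)
open Literature.MathematicalPhysics.QuantumFieldTheory.Balaban1983to89.B6SectADeltaACoerciveOneLevelV1 (cornerV1_mem_iterBlock_of_lamSite)
open Literature.MathematicalPhysics.QuantumFieldTheory.Balaban1983to89.B9LocalGaugeZeroModesY (inGauge_iff_qpK_mulVec_eq_zero gradK_mulVec_chart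
  gradK_mulVec_apply)
open Literature.MathematicalPhysics.QuantumFieldTheory.Balaban1983to89.B5Eq120IterProof (stairSum_grad stairSum_sub)
open Literature.MathematicalPhysics.QuantumFieldTheory.Balaban1983to89.B5Eq118OneStroke (iterBlock siteAvgIter_eq_blockSum)
open Literature.MathematicalPhysics.QuantumFieldTheory.Balaban1983to89.LatticeFieldCalculus (grad stairSum siteAvgIter)
open OpsYNablaBridge (chartY)
open scoped Matrix

variable {d ℓ : ℕ} {hd : 1 ≤ d + 1} {hL : Odd (ℓ + 1) ∧ 1 < ℓ + 1} {b₀ b₁ : ℝ} (i : KIdx d ℓ hd hL b₀ b₁)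

/-- `gradK·g` is r03's gradient of `g ∘ chart`. [cite: Balaban1985BackgroundPropagators, (3.3) p.390; Balaban1984PropagatorsII, (2.19) p.226, dictionary] -/
theorem gradK_mulVec_eq_grad (g : SiteY i → ℝ) : gradK i *ᵥ g = grad i.cf (fun x => g (chartY i x)) := by
  have h := gradK_mulVec_chart i (fun x => g (chartY i x))
  simpa only [Equiv.apply_symm_apply] using h

/-- ★★★ **THE SUPPORTED AXIAL DECOMPOSITION AT A CUBE.**  Let `D` be a set of box sites that is a union of blocks of the member's partition `𝔅` (every block
`B^j(y)`, `y ∈ Λ_j`, lies inside `D` or outside `D`), and `χ` a real bond cut issuing from `D` (`χ(b) ≠ 0 → b₋ ∈ D`).  Then every real bond field `v` has a gauge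
function `g` with **`qpK·g = 0`** (`g ∈ N(Q′)`), **`g = 0` off `D`**, such that `B := χ·v − gradK·g` has **vanishing staircase sums `B(Γ_{corner_j(y),x}) = 0` for
all `x ∈ B^j(y)` on every block inside `D`** ((2.121) at the corners) and **`B(b) = 0` on every bond with both end points outside `D`**.  (C2's global `λ` cut to
`D`; a gradient's staircase sum reads only the end points.) [cite: Balaban1984PropagatorsII, (2.7) p.224, (2.121) p.244, (2.90) p.239; Balaban1984PropagatorsI, (1.10) p.19] -/
theorem exists_supported_axial_decomposition (D : Finset (SiteY i))
    (hD : ∀ (j : ℕ) (y : Site (PV d ℓ i.m i.K hd hL) j), (domT i.hN i.D i.hk).LamSite j y →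
      (∀ x ∈ iterBlock j y, chartY i x ∈ D) ∨ (∀ x ∈ iterBlock j y, chartY i x ∉ D))
    {χ : FBondY i → ℝ} (hχD : ∀ b, χ b ≠ 0 → chartY i b.src ∈ D) (v : FBondY i → ℝ) :
    ∃ g : SiteY i → ℝ, qpK i *ᵥ g = 0 ∧ (∀ z, z ∉ D → g z = 0) ∧
      (∀ (j : ℕ) (y : Site (PV d ℓ i.m i.K hd hL) j), (domT i.hN i.D i.hk).LamSite j y → (∀ x ∈ iterBlock j y, chartY i x ∈ D) →
        ∀ x ∈ iterBlock j y, stairSum ((fun b => χ b * v b) - gradK i *ᵥ g) (cornerV1 j y) x = 0) ∧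
      (∀ b : FBondY i, chartY i b.src ∉ D → chartY i b.tgt ∉ D → ((fun b => χ b * v b) - gradK i *ᵥ g) b = 0) := by
  classical
  obtain ⟨n, hn, hstair⟩ := exists_treeGauge_decomposition (domT i.hN i.D i.hk) i.hcf (fun j y => cornerV1 j y)
    (cornerV1_mem_iterBlock_of_lamSite (domT i.hN i.D i.hk)) (WithLp.toLp 2 fun b => χ b * v b)
  have hlam : (domT i.hN i.D i.hk).InGauge (WithLp.ofLp n) := (mem_ker_QpE_iff (domT i.hN i.D i.hk) n).1 hn
  -- the cut gauge function
  let g : SiteY i → ℝ := fun z => if z ∈ D then WithLp.ofLp n ((chartY i).symm z) else 0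
  have hgD : ∀ x, chartY i x ∈ D → g (chartY i x) = WithLp.ofLp n x := fun x hx => by
    simp only [g, if_pos hx, Equiv.symm_apply_apply]
  have hgD' : ∀ x, chartY i x ∉ D → g (chartY i x) = 0 := fun x hx => by simp only [g, if_neg hx]
  refine ⟨g, ?_, fun z hz => by simp only [g, if_neg hz], ?_, ?_⟩
  · -- `g ∈ N(Q′)`: the block means vanish (blocks inside `D`: those of `λ`; outside: `g = 0`)
    rw [← inGauge_iff_qpK_mulVec_eq_zero]
    intro j y hy
    have hj : j ≤ (PV d ℓ i.m i.K hd hL).m + (PV d ℓ i.m i.K hd hL).K :=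
      ((domT i.hN i.D i.hk).le_of_lamSite hy).trans (domT i.hN i.D i.hk).hk
    rw [siteAvgIter_eq_blockSum j hj]
    rcases hD j y hy with hin | hout
    · have h := hlam j y hy
      rw [siteAvgIter_eq_blockSum j hj] at h
      rw [Finset.sum_congr rfl fun x hx => hgD x (hin x hx)]
      exact h
    · rw [Finset.sum_congr rfl fun x hx => hgD' x (hout x hx), Finset.sum_const_zero, smul_zero]
  · -- staircase sums on the blocks inside `D`
    intro j y hy hin x hx
    have hcor : cornerV1 j y ∈ iterBlock j y := cornerV1_mem_iterBlock_of_lamSite (domT i.hN i.D i.hk) j y hy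
    have h0 := hstair j y hy x hx
    rw [stairSum_sub_dE, WithLp.ofLp_toLp] at h0
    rw [gradK_mulVec_eq_grad, show ((fun b => χ b * v b) - grad i.cf fun x => g (chartY i x))
        = fun b => (fun b => χ b * v b) b - (grad i.cf fun x => g (chartY i x)) b from rfl,
      stairSum_sub, stairSum_grad, hgD x (hin x hx), hgD _ (hin _ hcor)]
    exact h0
  · -- bonds with both end points outside `D`
    intro b hs ht
    have hχ : χ b = 0 := by
      by_contra h
      exact hs (hχD b h)
    rw [Pi.sub_apply, gradK_mulVec_apply, hχ, zero_mul]
    simp only [g, if_neg hs, if_neg ht, sub_self, mul_zero]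

end Literature.MathematicalPhysics.QuantumFieldTheory.Balaban1983to89.B9LocalAxialDecompositionY

end
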